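import Mathlib.Analysis.InnerProductSpace.Spectrum
import Mathlib.Analysis.InnerProductSpace.Adjoint
import HarnessLib

/-!
# Frames normalising a positive-definite symmetric principal symbol, and the near-isometry of
# frames of nearby symbols (topic `Analysis/PDE`)

Analytic layer of the programme to prove short-time existence for quasilinear strictly
parabolic systems on a closed manifold (hypothesis `hQL` of
`Literature.Geometry.Riemannian.ricciFlow_shortTime_existence_of_quasilinear`). The fine
parametrix of that programme freezes the principal symbol `S` (a symmetric positive-definite
operator on the Euclidean model) at the centre of each patch and works in a linear frame `A`
with `A S A† = 1`, in which the frozen operator is the flat Laplacian. This file provides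

* `exists_symbolFrame` — for `S` symmetric with `ν₀‖x‖² ≤ ⟪Sx, x⟫` there is a continuous linear
  automorphism `A` with `A S A† = 1`, `A† = A`, `‖Ax‖² ≤ ν₀⁻¹‖x‖²`, `‖A⁻¹x‖² ≤ ‖S‖ ‖x‖²`
  (the eigenframe `A = S^{-1/2}` of the spectral theorem);
* `norm_sq_frame_comp_symm_le` — **frames of nearby symbols are nearly isometric**: if
  `A S A† = 1` and `A' S' A'† = 1` then `‖A' A⁻¹‖² ≤ 1 + ‖A'‖² ‖S - S'‖` — pure algebra
  (`(A'A⁻¹)(A'A⁻¹)† = A' S A'† = 1 + A'(S - S')A'†` and the `C*`-identity), with no continuity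
  of the frame in the symbol needed. This is what makes the transport of top-order errors
  between adjacent patches of the fine parametrix cost only `(1 + Cω(δ))^{2ℓ}` at level `ℓ`.

Everything is proved; no named fact and no `sorry` is introduced.

## References

* L. Hörmander, *The Analysis of Linear Partial Differential Operators III*, Springer 1985,
  §17.1 (freezing the principal symbol; reduction of a constant-coefficient elliptic operator to
  the Laplacian by a linear change of variables). [Hormander1985III]
-/

noncomputable section

open Filter Topology
open scoped RealInnerProductSpace InnerProductSpace

namespace Literature.Analysis.PDE

variable {E : Type*} [NormedAddCommGroup E] [InnerProductSpace ℝ E]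

/-! ### Expansions in an orthonormal basis -/

section ONB

variable {ι : Type*} [Fintype ι] (v : OrthonormalBasis ι ℝ E)

/-- Coefficient extraction: `⟪vⱼ, Σᵢ aᵢ vᵢ⟫ = aⱼ`. [folklore] -/
theorem inner_basis_sum_smul [DecidableEq ι] (a : ι → ℝ) (j : ι) :
    ⟪v j, ∑ i, a i • v i⟫ = a j := by
  rw [inner_sum]
  simp_rw [inner_smul_right]
  have h : ∀ i, ⟪v j, v i⟫ = if j = i then (1 : ℝ) else 0 := fun i ↦
    orthonormal_iff_ite.1 v.orthonormal j i
  simp_rw [h, mul_ite, mul_one, mul_zero]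
  rw [Finset.sum_ite_eq]
  simp

/-- Parseval for a finite expansion: `‖Σᵢ aᵢ vᵢ‖² = Σᵢ aᵢ²`. [folklore] -/
theorem norm_sq_sum_smul [DecidableEq ι] (a : ι → ℝ) : ‖∑ i, a i • v i‖ ^ 2 = ∑ i, a i ^ 2 := by
  rw [← v.sum_sq_inner_right]
  refine Finset.sum_congr rfl fun j _ ↦ ?_
  rw [inner_basis_sum_smul v a j]

/-- The continuous linear map `x ↦ Σᵢ cᵢ ⟪vᵢ, x⟫ vᵢ` (diagonal in the basis `v`).
[folklore] -/
def diagCLM (c : ι → ℝ) : E →L[ℝ] E := ∑ i, c i • (innerSL ℝ (v i)).smulRight (v i)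

/-- `diagCLM_apply`: the diagonal map expanded. [folklore] -/
theorem diagCLM_apply (c : ι → ℝ) (x : E) : diagCLM v c x = ∑ i, (c i * ⟪v i, x⟫) • v i := by
  simp only [diagCLM, FunLike.coe_sum, Finset.sum_apply, FunLike.coe_smul, Pi.smul_apply,
    ContinuousLinearMap.smulRight_apply, innerSL_apply_apply, smul_smul]

/-- The diagonal map on a basis vector. [folklore] -/
theorem diagCLM_basis [DecidableEq ι] (c : ι → ℝ) (j : ι) : diagCLM v c (v j) = c j • v j := by
  rw [diagCLM_apply]
  have h : ∀ i, ⟪v i, v j⟫ = if i = j then (1 : ℝ) else 0 := fun i ↦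
    orthonormal_iff_ite.1 v.orthonormal i j
  simp_rw [h, mul_ite, mul_one, mul_zero, ite_smul, zero_smul]
  rw [Finset.sum_ite_eq']
  simp

/-- Composition of diagonal maps is diagonal with the product of the entries. [folklore] -/
theorem diagCLM_diagCLM [DecidableEq ι] (c d : ι → ℝ) (x : E) :
    diagCLM v c (diagCLM v d x) = diagCLM v (fun i ↦ c i * d i) x := by
  rw [diagCLM_apply v d x, diagCLM_apply, diagCLM_apply]
  refine Finset.sum_congr rfl fun i _ ↦ ?_
  rw [inner_basis_sum_smul v _ i, mul_assoc]

/-- The diagonal map with entries `1` is the identity. [folklore] -/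
theorem diagCLM_one (x : E) : diagCLM v (fun _ ↦ (1 : ℝ)) x = x := by
  rw [diagCLM_apply]
  simp_rw [one_mul]
  exact v.sum_repr' x

/-- The diagonal map is symmetric. [folklore] -/
theorem diagCLM_inner_symm (c : ι → ℝ) (x y : E) : ⟪diagCLM v c x, y⟫ = ⟪x, diagCLM v c y⟫ := by
  rw [diagCLM_apply, diagCLM_apply, sum_inner, inner_sum]
  refine Finset.sum_congr rfl fun i _ ↦ ?_
  rw [inner_smul_left, inner_smul_right]
  simp only [RCLike.conj_to_real]
  rw [real_inner_comm (v i) x]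
  ring

/-- `diagCLM_adjoint`: the diagonal map is self-adjoint. [folklore] -/
theorem diagCLM_adjoint [FiniteDimensional ℝ E] (c : ι → ℝ) :
    ContinuousLinearMap.adjoint (diagCLM v c) = diagCLM v c := by
  haveI : CompleteSpace E := FiniteDimensional.complete ℝ E
  exact ((ContinuousLinearMap.eq_adjoint_iff (diagCLM v c) (diagCLM v c)).2
    fun x y ↦ diagCLM_inner_symm v c x y).symm

/-- The norm of the diagonal map: `‖diag(c) x‖² = Σᵢ cᵢ² ⟪vᵢ, x⟫²`. [folklore] -/
theorem norm_sq_diagCLM [DecidableEq ι] (c : ι → ℝ) (x : E) :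
    ‖diagCLM v c x‖ ^ 2 = ∑ i, c i ^ 2 * ⟪v i, x⟫ ^ 2 := by
  rw [diagCLM_apply, norm_sq_sum_smul]
  refine Finset.sum_congr rfl fun i _ ↦ ?_
  ring

/-- If `cᵢ² ≤ K` for all `i` then `‖diag(c) x‖² ≤ K ‖x‖²`. [folklore] -/
theorem norm_sq_diagCLM_le [DecidableEq ι] (c : ι → ℝ) {K : ℝ} (hK : ∀ i, c i ^ 2 ≤ K) (x : E) :
    ‖diagCLM v c x‖ ^ 2 ≤ K * ‖x‖ ^ 2 := by
  rw [norm_sq_diagCLM, ← v.sum_sq_inner_right x, Finset.mul_sum]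
  exact Finset.sum_le_sum fun i _ ↦ mul_le_mul_of_nonneg_right (hK i) (sq_nonneg _)

end ONB

/-! ### The eigenframe of a coercive symmetric symbol -/

section Frame

variable [FiniteDimensional ℝ E]

/-- **Frames normalising a coercive symmetric symbol**: for `S` symmetric with
`ν₀ ‖x‖² ≤ ⟪S x, x⟫` (`ν₀ > 0`) there is a continuous linear automorphism `A` with
`A S A = 1`, `A† = A`, `‖A x‖² ≤ ν₀⁻¹ ‖x‖²` and `‖A⁻¹ x‖² ≤ ‖S‖ ‖x‖²` — in the frame `A` the
constant-coefficient operator with symbol `S` is the Laplacian. (The eigenframe `S^{-1/2}` of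
the spectral theorem.) [cite: Hormander1985III, §17.1] -/
theorem exists_symbolFrame {S : E →L[ℝ] E} (hS : (S : E →ₗ[ℝ] E).IsSymmetric) {ν₀ : ℝ}
    (hν₀ : 0 < ν₀) (hcoer : ∀ x, ν₀ * ‖x‖ ^ 2 ≤ ⟪S x, x⟫) :
    ∃ A : E ≃L[ℝ] E, (∀ x, A (S (A x)) = x) ∧
      ContinuousLinearMap.adjoint (A : E →L[ℝ] E) = A ∧
      (∀ x, ‖A x‖ ^ 2 ≤ ν₀⁻¹ * ‖x‖ ^ 2) ∧ (∀ x, ‖A.symm x‖ ^ 2 ≤ ‖S‖ * ‖x‖ ^ 2) := by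
  classical
  set n := Module.finrank ℝ E
  set v : OrthonormalBasis (Fin n) ℝ E := hS.eigenvectorBasis rfl with hv
  set lam : Fin n → ℝ := hS.eigenvalues rfl with hlam
  have hSv : ∀ i, S (v i) = lam i • v i := fun i ↦ hS.apply_eigenvectorBasis rfl i
  -- the eigenvalues are pinched between `ν₀` and `‖S‖`
  have hvn : ∀ i, ‖v i‖ = 1 := fun i ↦ v.orthonormal.1 i
  have hlam_eq : ∀ i, lam i = ⟪S (v i), v i⟫ := fun i ↦ by
    rw [hSv i, inner_smul_left, real_inner_self_eq_norm_sq, hvn i]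
    simp
  have hlam_ge : ∀ i, ν₀ ≤ lam i := fun i ↦ by
    have h := hcoer (v i)
    rw [hvn i, one_pow, mul_one, ← hlam_eq i] at h
    exact h
  have hlam_pos : ∀ i, 0 < lam i := fun i ↦ hν₀.trans_le (hlam_ge i)
  have hlam_le : ∀ i, lam i ≤ ‖S‖ := fun i ↦ by
    rw [hlam_eq i]
    calc ⟪S (v i), v i⟫ ≤ ‖S (v i)‖ * ‖v i‖ := real_inner_le_norm _ _
      _ ≤ ‖S‖ * ‖v i‖ * ‖v i‖ := mul_le_mul_of_nonneg_right (S.le_opNorm _) (norm_nonneg _)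
      _ = ‖S‖ := by rw [hvn i]; ring
  -- the frame `A = S^{-1/2}` and its inverse `S^{1/2}`
  set c : Fin n → ℝ := fun i ↦ (Real.sqrt (lam i))⁻¹ with hc
  set c' : Fin n → ℝ := fun i ↦ Real.sqrt (lam i) with hc'
  have hcc' : ∀ i, c i * c' i = 1 := fun i ↦
    inv_mul_cancel₀ (Real.sqrt_pos.2 (hlam_pos i)).ne'
  have hc'c : ∀ i, c' i * c i = 1 := fun i ↦ by rw [mul_comm]; exact hcc' i
  set A₀ := diagCLM v c
  set B₀ := diagCLM v c'
  have hAB : ∀ x, A₀ (B₀ x) = x := fun x ↦ by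
    rw [diagCLM_diagCLM]
    simp_rw [hcc']
    exact diagCLM_one v x
  have hBA : ∀ x, B₀ (A₀ x) = x := fun x ↦ by
    rw [diagCLM_diagCLM]
    simp_rw [hc'c]
    exact diagCLM_one v x
  set A : E ≃L[ℝ] E := ContinuousLinearEquiv.equivOfInverse A₀ B₀ hBA hAB with hA
  have hAco : (A : E →L[ℝ] E) = A₀ := rfl
  have hAap : ∀ x, A x = A₀ x := fun _ ↦ rfl
  have hAsy : ∀ x, A.symm x = B₀ x := fun _ ↦ rfl
  refine ⟨A, fun x ↦ ?_, ?_, fun x ↦ ?_, fun x ↦ ?_⟩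
  · -- `A S A x = x`: expand `A x` in the basis, apply `S` and `A`
    have hA₀v : ∀ i, A₀ (v i) = c i • v i := fun i ↦ diagCLM_basis v c i
    have h2 : ∀ i, c i * c i * lam i = 1 := fun i ↦ by
      rw [hc]
      simp only
      rw [← mul_inv, Real.mul_self_sqrt (hlam_pos i).le, inv_mul_cancel₀ (hlam_pos i).ne']
    rw [hAap, hAap, diagCLM_apply v c x, map_sum, map_sum]
    simp only [map_smul, hSv, smul_smul, hA₀v]
    refine (Finset.sum_congr rfl fun i _ ↦ ?_).trans (v.sum_repr' x)
    congr 1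
    linear_combination ⟪v i, x⟫ * h2 i
  · rw [hAco]
    exact diagCLM_adjoint v c
  · rw [hAap]
    refine norm_sq_diagCLM_le v c (fun i ↦ ?_) x
    rw [hc]
    simp only
    rw [inv_pow, Real.sq_sqrt (hlam_pos i).le]
    exact (inv_le_inv₀ (hlam_pos i) hν₀).2 (hlam_ge i)
  · rw [hAsy]
    refine norm_sq_diagCLM_le v c' (fun i ↦ ?_) x
    rw [hc']
    simp only
    rw [Real.sq_sqrt (hlam_pos i).le]
    exact hlam_le i

end Frame

/-! ### Near-isometry of frames of nearby symbols -/

section NearIsometry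

variable [FiniteDimensional ℝ E]

/-- For a frame with `A S A† = 1` and `S` self-adjoint: `A⁻¹ (A⁻¹)† = S`. [folklore] -/
theorem symm_comp_adjoint_symm_eq {S : E →L[ℝ] E}
    (hS : ContinuousLinearMap.adjoint S = S) {A : E ≃L[ℝ] E}
    (hA : (A : E →L[ℝ] E) ∘L S ∘L ContinuousLinearMap.adjoint (A : E →L[ℝ] E) = 1) :
    (A.symm : E →L[ℝ] E) ∘L ContinuousLinearMap.adjoint (A.symm : E →L[ℝ] E) = S := by
  haveI : CompleteSpace E := FiniteDimensional.complete ℝ E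
  -- `S A† = A⁻¹`
  have h1 : S ∘L ContinuousLinearMap.adjoint (A : E →L[ℝ] E) = (A.symm : E →L[ℝ] E) := by
    calc S ∘L ContinuousLinearMap.adjoint (A : E →L[ℝ] E)
        = ((A.symm : E →L[ℝ] E) ∘L (A : E →L[ℝ] E)) ∘L
            (S ∘L ContinuousLinearMap.adjoint (A : E →L[ℝ] E)) := by
          rw [ContinuousLinearEquiv.coe_symm_comp_coe, ContinuousLinearMap.id_comp]
      _ = (A.symm : E →L[ℝ] E) ∘L
            ((A : E →L[ℝ] E) ∘L S ∘L ContinuousLinearMap.adjoint (A : E →L[ℝ] E)) := by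
          simp only [ContinuousLinearMap.comp_assoc]
      _ = (A.symm : E →L[ℝ] E) := by
          rw [hA, ContinuousLinearMap.one_def, ContinuousLinearMap.comp_id]
  -- adjoints: `(A⁻¹)† = A S`
  have h2 : ContinuousLinearMap.adjoint (A.symm : E →L[ℝ] E) = (A : E →L[ℝ] E) ∘L S := by
    rw [← h1, ContinuousLinearMap.adjoint_comp, ContinuousLinearMap.adjoint_adjoint, hS]
  rw [h2, ← ContinuousLinearMap.comp_assoc, ContinuousLinearEquiv.coe_symm_comp_coe,
    ContinuousLinearMap.id_comp]

/-- `‖M M†‖ = ‖M‖²` (the `C*`-identity for `M†`). [folklore] -/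
theorem norm_comp_adjoint_self (M : E →L[ℝ] E) :
    ‖M ∘L ContinuousLinearMap.adjoint M‖ = ‖M‖ * ‖M‖ := by
  haveI : CompleteSpace E := FiniteDimensional.complete ℝ E
  have h := ContinuousLinearMap.norm_adjoint_comp_self (ContinuousLinearMap.adjoint M)
  rw [ContinuousLinearMap.adjoint_adjoint] at h
  rw [h, ContinuousLinearMap.adjoint.norm_map]

/-- **Frames of nearby symbols are nearly isometric**: if `A S A† = 1` and `A' S' A'† = 1`
with `S` self-adjoint, then `‖A' ∘ A⁻¹‖² ≤ 1 + ‖A'‖² ‖S - S'‖`. [cite: Hormander1985III, §17.1] -/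
theorem norm_sq_frame_comp_symm_le {S S' : E →L[ℝ] E} (hS : ContinuousLinearMap.adjoint S = S)
    {A A' : E ≃L[ℝ] E}
    (hA : (A : E →L[ℝ] E) ∘L S ∘L ContinuousLinearMap.adjoint (A : E →L[ℝ] E) = 1)
    (hA' : (A' : E →L[ℝ] E) ∘L S' ∘L ContinuousLinearMap.adjoint (A' : E →L[ℝ] E) = 1) :
    ‖(A' : E →L[ℝ] E) ∘L (A.symm : E →L[ℝ] E)‖ ^ 2 ≤
      1 + ‖(A' : E →L[ℝ] E)‖ ^ 2 * ‖S - S'‖ := by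
  haveI : CompleteSpace E := FiniteDimensional.complete ℝ E
  set M : E →L[ℝ] E := (A' : E →L[ℝ] E) ∘L (A.symm : E →L[ℝ] E) with hM
  -- `M M† = A' S A'† = 1 + A'(S - S')A'†`
  have hMM : M ∘L ContinuousLinearMap.adjoint M =
      1 + (A' : E →L[ℝ] E) ∘L (S - S') ∘L ContinuousLinearMap.adjoint (A' : E →L[ℝ] E) := by
    have h3 := symm_comp_adjoint_symm_eq hS hA
    calc M ∘L ContinuousLinearMap.adjoint M
        = (A' : E →L[ℝ] E) ∘L ((A.symm : E →L[ℝ] E) ∘L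
            ContinuousLinearMap.adjoint (A.symm : E →L[ℝ] E)) ∘L
              ContinuousLinearMap.adjoint (A' : E →L[ℝ] E) := by
          rw [hM, ContinuousLinearMap.adjoint_comp]
          simp only [ContinuousLinearMap.comp_assoc]
      _ = (A' : E →L[ℝ] E) ∘L (S' + (S - S')) ∘L ContinuousLinearMap.adjoint (A' : E →L[ℝ] E) := by
          rw [h3, add_sub_cancel]
      _ = (A' : E →L[ℝ] E) ∘L S' ∘L ContinuousLinearMap.adjoint (A' : E →L[ℝ] E) +
            (A' : E →L[ℝ] E) ∘L (S - S') ∘L ContinuousLinearMap.adjoint (A' : E →L[ℝ] E) := by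
          rw [ContinuousLinearMap.add_comp, ContinuousLinearMap.comp_add]
      _ = 1 + (A' : E →L[ℝ] E) ∘L (S - S') ∘L ContinuousLinearMap.adjoint (A' : E →L[ℝ] E) := by
          rw [hA']
  have hsq : ‖M‖ ^ 2 = ‖M ∘L ContinuousLinearMap.adjoint M‖ := by
    rw [sq, norm_comp_adjoint_self]
  rw [hsq, hMM]
  calc ‖(1 : E →L[ℝ] E) + (A' : E →L[ℝ] E) ∘L (S - S') ∘L ContinuousLinearMap.adjoint (A' : E →L[ℝ] E)‖
      ≤ ‖(1 : E →L[ℝ] E)‖ +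
          ‖(A' : E →L[ℝ] E) ∘L (S - S') ∘L ContinuousLinearMap.adjoint (A' : E →L[ℝ] E)‖ :=
        norm_add_le _ _
    _ ≤ 1 + ‖(A' : E →L[ℝ] E)‖ * (‖S - S'‖ * ‖ContinuousLinearMap.adjoint (A' : E →L[ℝ] E)‖) := by
        refine add_le_add ContinuousLinearMap.norm_id_le ?_
        refine (ContinuousLinearMap.opNorm_comp_le _ _).trans ?_
        exact mul_le_mul_of_nonneg_left (ContinuousLinearMap.opNorm_comp_le _ _) (norm_nonneg _)
    _ = 1 + ‖(A' : E →L[ℝ] E)‖ ^ 2 * ‖S - S'‖ := by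
        rw [ContinuousLinearMap.adjoint.norm_map]
        ring

/-- The frame identity in composition form from the pointwise form, for a self-adjoint frame.
[folklore] -/
theorem frame_comp_eq_one {S : E →L[ℝ] E} {A : E ≃L[ℝ] E} (h : ∀ x, A (S (A x)) = x)
    (hAadj : ContinuousLinearMap.adjoint (A : E →L[ℝ] E) = A) :
    (A : E →L[ℝ] E) ∘L S ∘L ContinuousLinearMap.adjoint (A : E →L[ℝ] E) = 1 := by
  rw [hAadj]
  ext x
  exact h x

end NearIsometry

end Literature.Analysis.PDE

end
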